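import Mathlib
import Summits.AtomisticToContinuum.Crystallization.Theorems.ThreeConeCertificateExactCertificateTransfer1DCore

/-!
# Crux `ExactCertificate` (stmt-AtomisticToContinuum-11959), line `closure-makes-nogap-exact`,
# Transfer skeleton V (`OneCrossingChainCertificate`) — stub `stub_classCore`:
# the core inequality `F_a ≤ V` on `(0,a)` for the one-crossing Laplace class

Support file (`--supports stmt-AtomisticToContinuum-11959`); nothing here closes the 3-D crux.

Class form of `stub_coreOf` (file `…Transfer1DCore.lean`, `V = lennardJones`): for an abstract pair potential
with Laplace representation `V(c) = −∫₀^∞ e^{−tc} p(t) dt` (`c > 0`), a zero-pressure spacing `a > 0`, chain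
summability of `k ↦ (k+1)V(y + (k+1)a)` (`y ≥ 0`) and the single-crossing statement (conclusion of
`stub_classCrossing`, taken as a hypothesis), the tail interpolant
`F_a(x) = Σ_{k≥0} (k+1)[V(|x+a|+(k+1)a) − 2V(|x|+(k+1)a) + V(|x−a|+(k+1)a)]` satisfies `F_a(r) ≤ V(r)` for
`0 < r < a`:

* reindexing (`hasSum_second_difference`): with `u = a − r`,
  `V(r) − F_a(r) = Σ_{k≥0} (k+1)·[V((k+1)a − u) − V((k+1)a + u)]`;
* Laplace: `V((k+1)a − u) − V((k+1)a + u) = 2∫₀^∞ e^{−t(k+1)a} p(t)·t·h(t) dt` with `h(t) = −sinh(tu)/t`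
  (`classCore_crossing_integrand`), and `h` is antitone on `(0,∞)` (`antitoneOn_neg_sinh_div`);
* the crossing statement gives `Σ_k (k+1)∫₀^∞ e^{−t(k+1)a} p(t) t h(t) dt ≥ 0`, i.e. `V(r) − F_a(r) ≥ 0`.
-/

noncomputable section

namespace Summit.AtomisticToContinuum.Crystallization.Theorems.ThreeConeCertificateExactCertificate.Transfer1D

open Literature.MathematicalPhysics.StatisticalMechanics MeasureTheory Set Filter Topology
open scoped BigOperators

/-- The crossing integrand for `h(t) = −sinh(tu)/t` and an abstract density `p`: for `t > 0`,
`e^{−tb} p(t)·(t·h(t)) = −½·(e^{−t(b−u)} p(t) − e^{−t(b+u)} p(t))`. [folklore] -/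
theorem classCore_crossing_integrand (p : ℝ → ℝ) (b u : ℝ) {t : ℝ} (ht : 0 < t) :
    Real.exp (-(t * b)) * p t * (t * (-(Real.sinh (t * u) / t)))
      = -(1 / 2) * (Real.exp (-(t * (b - u))) * p t - Real.exp (-(t * (b + u))) * p t) := by
  have ht0 : t ≠ 0 := ht.ne'
  have e1 : Real.exp (-(t * (b - u))) = Real.exp (-(t * b)) * Real.exp (t * u) := by
    rw [← Real.exp_add]; congr 1; ring
  have e2 : Real.exp (-(t * (b + u))) = Real.exp (-(t * b)) * Real.exp (-(t * u)) := by
    rw [← Real.exp_add]; congr 1; ring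
  have e3 : t * (-(Real.sinh (t * u) / t)) = -Real.sinh (t * u) := by
    field_simp
  rw [e1, e2, e3, Real.sinh_eq]
  ring

/-- If `k ↦ (k+1)·f k` is summable (over `ℝ`), then so is `f` (`|f k| ≤ |(k+1) f k|`). [folklore] -/
theorem classCore_summable_of_weighted {f : ℕ → ℝ}
    (hf : Summable (fun k : ℕ => ((k : ℝ) + 1) * f k)) : Summable f := by
  refine Summable.of_norm_bounded hf.norm fun k => ?_
  rw [Real.norm_eq_abs, Real.norm_eq_abs, abs_mul, abs_of_pos (by positivity : (0 : ℝ) < (k : ℝ) + 1)]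
  exact le_mul_of_one_le_left (abs_nonneg _) (by linarith [(k.cast_nonneg : (0 : ℝ) ≤ k)])

/-- **STUB `stub_classCore`** (registered on stmt-AtomisticToContinuum-11959, Transfer skeleton V) — THE CORE
INEQUALITY `F_a ≤ V` ON `(0,a)` (class form of `stub_coreOf`): for a pair potential `V(c) = −∫₀^∞ e^{−tc}p(t)dt`
of the one-crossing Laplace class, a zero-pressure spacing `a > 0`, chain summability and the single-crossing
statement (hypothesis), `V(r) − F_a(r) = Σ_k(k+1)[V((k+1)a−u) − V((k+1)a+u)]
= 2Σ_k(k+1)∫₀^∞e^{−t(k+1)a}p(t)·t·h(t)dt ≥ 0` with `u = a − r` and the antitone weight `h(t) = −sinh(tu)/t`.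
[folklore] -/
theorem stub_classCore : ∀ (V p : ℝ → ℝ) (a : ℝ), 0 < a →
    (∀ r : ℝ, 0 < r → IntegrableOn (fun t : ℝ => Real.exp (-(t * r)) * p t) (Set.Ioi 0)) →
    (∀ r : ℝ, 0 < r → V r = -(∫ t in Set.Ioi (0 : ℝ), Real.exp (-(t * r)) * p t)) →
    (∀ y : ℝ, 0 ≤ y → Summable (fun k : ℕ => ((k : ℝ) + 1) * V (y + ((k : ℝ) + 1) * a))) →
    (∀ h : ℝ → ℝ, AntitoneOn h (Set.Ioi 0) →
      (∀ k : ℕ, IntegrableOn (fun t : ℝ => Real.exp (-(t * (((k : ℝ) + 1) * a))) * p t * (t * h t)) (Set.Ioi 0)) →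
      Summable (fun k : ℕ => ((k : ℝ) + 1) *
        ∫ t in Set.Ioi (0 : ℝ), Real.exp (-(t * (((k : ℝ) + 1) * a))) * p t * (t * h t)) →
      0 ≤ ∑' k : ℕ, ((k : ℝ) + 1) *
        ∫ t in Set.Ioi (0 : ℝ), Real.exp (-(t * (((k : ℝ) + 1) * a))) * p t * (t * h t)) →
    ∀ r : ℝ, 0 < r → r < a →
      ∑' k : ℕ, ((k : ℝ) + 1) * (V (|r + a| + ((k : ℝ) + 1) * a) - 2 * V (|r| + ((k : ℝ) + 1) * a)
        + V (|r - a| + ((k : ℝ) + 1) * a)) ≤ V r := by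
  intro V p a ha hint hV hsum hCR r hr hra
  -- `u = a − r ∈ (0, a)`
  set u : ℝ := a - r with hu
  have hu0 : 0 < u := sub_pos.2 hra
  -- the two chain families `A_k = V((k+1)a − u) = V(r + ka)`, `B_k = V((k+1)a + u) = V(u + (k+1)a)`
  set A : ℕ → ℝ := fun k => V (((k : ℝ) + 1) * a - u) with hAdef
  set B : ℕ → ℝ := fun k => V (((k : ℝ) + 1) * a + u) with hBdef
  -- summability of the weighted families (chain summability at `y = u` and `y = r`, the latter shifted by one)
  have hsB : Summable (fun k : ℕ => ((k : ℝ) + 1) * B k) := by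
    refine (hsum u hu0.le).congr fun k => ?_
    have e : B k = V (u + ((k : ℝ) + 1) * a) := by
      simp only [hBdef]
      congr 1
      ring
    rw [e]
  have hsA : Summable (fun k : ℕ => ((k : ℝ) + 1) * A k) := by
    have h1 := hsum r hr.le
    have h2 : Summable (fun k : ℕ => V (r + ((k : ℝ) + 1) * a)) := classCore_summable_of_weighted h1
    refine (summable_nat_add_iff 1).1 ?_
    refine (h1.add h2).congr fun k => ?_
    have e : A (k + 1) = V (r + ((k : ℝ) + 1) * a) := by
      simp only [hAdef]
      congr 1
      rw [hu]; push_cast; ring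
    show ((k : ℝ) + 1) * V (r + ((k : ℝ) + 1) * a) + V (r + ((k : ℝ) + 1) * a)
      = (((k + 1 : ℕ) : ℝ) + 1) * A (k + 1)
    rw [e]; push_cast; ring
  have hsA0 : Summable A := classCore_summable_of_weighted hsA
  -- positivity of the arguments
  have hbu : ∀ k : ℕ, 0 < ((k : ℝ) + 1) * a - u := fun k => by
    have hk : (0 : ℝ) ≤ (k : ℝ) * a := by positivity
    rw [hu]; linarith
  have hbu' : ∀ k : ℕ, 0 < ((k : ℝ) + 1) * a + u := fun k => by positivity
  -- STEP 1: reindexing `F_a(r) = V(r) − (Σ(k+1)A_k − Σ(k+1)B_k)`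
  have hF : HasSum (fun k : ℕ => ((k : ℝ) + 1) * (V (|r + a| + ((k : ℝ) + 1) * a)
      - 2 * V (|r| + ((k : ℝ) + 1) * a) + V (|r - a| + ((k : ℝ) + 1) * a)))
      (V r - (∑' k : ℕ, ((k : ℝ) + 1) * A k - ∑' k : ℕ, ((k : ℝ) + 1) * B k)) := by
    have h := hasSum_second_difference hsA.hasSum hsA0.hasSum hsB.hasSum
    have hA0r : A 0 = V r := by
      simp only [hAdef, Nat.cast_zero, zero_add, one_mul, hu, sub_sub_cancel]
    rw [hA0r] at h
    refine h.congr_fun fun k => ?_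
    have e1 : |r + a| + ((k : ℝ) + 1) * a = (((k + 2 : ℕ) : ℝ) + 1) * a - u := by
      rw [abs_of_pos (by linarith), hu]; push_cast; ring
    have e2 : |r| + ((k : ℝ) + 1) * a = (((k + 1 : ℕ) : ℝ) + 1) * a - u := by
      rw [abs_of_pos hr, hu]; push_cast; ring
    have e3 : |r - a| + ((k : ℝ) + 1) * a = ((k : ℝ) + 1) * a + u := by
      rw [abs_of_neg (by linarith), hu]; ring
    rw [e1, e2, e3]
  rw [hF.tsum_eq]
  -- STEP 2: it remains `0 ≤ Σ(k+1)A_k − Σ(k+1)B_k`, from the crossing statement with `h(t) = −sinh(tu)/t`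
  suffices hpos : 0 ≤ ∑' k : ℕ, ((k : ℝ) + 1) * A k - ∑' k : ℕ, ((k : ℝ) + 1) * B k by linarith
  set h : ℝ → ℝ := fun t => -(Real.sinh (t * u) / t) with hhdef
  -- Laplace: the crossing integral of index `k` equals `(A_k − B_k)/2`
  have hcongr : ∀ k : ℕ, EqOn
      (fun t : ℝ => Real.exp (-(t * (((k : ℝ) + 1) * a))) * p t * (t * h t))
      (fun t : ℝ => -(1 / 2) * (Real.exp (-(t * (((k : ℝ) + 1) * a - u))) * p t
        - Real.exp (-(t * (((k : ℝ) + 1) * a + u))) * p t)) (Ioi 0) :=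
    fun k t ht => classCore_crossing_integrand p _ _ ht
  have hintk : ∀ k : ℕ, ∫ t in Ioi (0 : ℝ), Real.exp (-(t * (((k : ℝ) + 1) * a))) * p t * (t * h t)
      = (1 / 2) * (A k - B k) := by
    intro k
    rw [setIntegral_congr_fun measurableSet_Ioi (hcongr k), integral_const_mul,
      integral_sub (hint _ (hbu k)) (hint _ (hbu' k))]
    simp only [hAdef, hBdef]
    rw [hV _ (hbu k), hV _ (hbu' k)]
    ring
  -- the three hypotheses of the crossing statement
  have hanti : AntitoneOn h (Ioi 0) := antitoneOn_neg_sinh_div hu0.le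
  have hInt : ∀ k : ℕ, IntegrableOn
      (fun t : ℝ => Real.exp (-(t * (((k : ℝ) + 1) * a))) * p t * (t * h t)) (Ioi 0) := by
    intro k
    refine IntegrableOn.congr_fun ?_ (hcongr k).symm measurableSet_Ioi
    exact ((hint _ (hbu k)).sub (hint _ (hbu' k))).const_mul _
  have hfun : (fun k : ℕ => ((k : ℝ) + 1) * ∫ t in Ioi (0 : ℝ), Real.exp (-(t * (((k : ℝ) + 1) * a)))
      * p t * (t * h t))
      = fun k : ℕ => (1 / 2) * (((k : ℝ) + 1) * A k - ((k : ℝ) + 1) * B k) := by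
    funext k
    rw [hintk k]
    ring
  have hSum : Summable (fun k : ℕ => ((k : ℝ) + 1) * ∫ t in Ioi (0 : ℝ),
      Real.exp (-(t * (((k : ℝ) + 1) * a))) * p t * (t * h t)) := by
    rw [hfun]
    exact (hsA.sub hsB).mul_left _
  have key := hCR h hanti hInt hSum
  rw [hfun, tsum_mul_left, hsA.tsum_sub hsB] at key
  linarith

end Summit.AtomisticToContinuum.Crystallization.Theorems.ThreeConeCertificateExactCertificate.Transfer1D

end
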